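import Summits.BirchSwinnertonDyer.BirchSwinnertonDyer.Theorems.GenusKolyvaginAtTwoGenusPrimitiveSupplyAtTwoPosDiscShallowArchimedeanBitOnFour
import HarnessLib

/-!
# Route `GenusKolyvaginAtTwo`, crux 25504 (Δ>0 supply), K₄⁺ cell: THE ALL-SILENT TWIN HAS `#Sel₂ = 2` AND IS STRICT AT `∞` — UNCONDITIONAL

Seat `bsd-line-gk2-p5` g34 (cell `bsd-f1-sign2`, WIDTH-5 attach), `--supports stmt-BirchSwinnertonDyer-25504 --as helper`.  THEOREMS ONLY (no
definition, no named fact, no `sorry`); UNCONDITIONAL.  **BSD is NOT proved by this file and no item is closed by it.**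

The K₄⁺ clause of the crux `GenusPrimitiveSupplyAtTwoPosDiscShallow` reads `#Sel₂(E) = 4 ∧ ∃ c ∈ Sel₂(E), loc_∞ c ≠ 0`.  Companion of
`…ArchimedeanBitOnFour` (engine run BACKWARDS for `(Wd, W)`): here Mazur–Rubin Cor. 3.4 (i), NON-STRICT direction with `T = {∞}`, is run
FORWARDS for the pair `(W, Wd)` — the master datum `(φ, φ′)` of `exists_intertwining_master_frame` as is, the transported structure
`𝓐′ v = φ_* 𝓛_v(Wd)` on `H¹(ℚ_v, E[2])`, agreement off `∞` from the three-row menu (transported back along `φ′ ∘ φ = id`), transversality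
at `∞` = the master datum's real clause verbatim:

* §1 `natCard_selmerGroup_twin_mul_two_eq_of_localization_real_ne_zero`: a class of `Sel₂(E)` non-trivial at `∞` ⟹ `#Sel₂(Wd)·2 = #Sel₂(E)`.
* §2 **`natCard_selmerGroup_twin_eq_two_of_kFourPos`**: on the K₄⁺ cell `#Sel₂(Wd) = 2` — the frame hypothesis `#Sel₂(Wd) = 2` of the
  LEAD's `C⁺‴` is AUTOMATIC there (no Gross–Zagier–Kolyvagin, no BSD); and **`twin_selmer_localization_real_eq_zero_of_kFourPos`**: every
  class of `Sel₂(Wd)` is strict at `∞` (by `…OnFour`).  Reading: `Sel₂(Wd) = Sel₂(E)_{str ∞}` has order `2`; with `rank Wd(ℚ) = 1` on the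
  frame this is `Ш(Wd)[2] = 0` and the generator of `Wd(ℚ)` off the egg — the K₄⁺ cell's twin is `2`-Selmer-minimal for free.

* §3 (append) `natCard_selmerGroup_twin_eq_eight_of_forall_localization_real_eq_zero` (UP direction: `Sel₂(E)` strict at `∞`, `#Sel₂(E) = 4`
  ⟹ `#Sel₂(Wd) = 8`) and **`exists_localization_real_ne_zero_of_natCard_selmerGroup_twin_eq_two`**: the frame's `#Sel₂(Wd) = 2` on a
  `#Sel₂(E) = 4` cell FORCES the K₄⁺ clause — the crux's side condition is exactly the inhabited part of the cell.

References: [MazurRubin2010] Lemma 2.9, Prop. 3.3, Cor. 3.4 (i); [Kramer1981] §2 Prop. 6, Thm. 1; [MilneADT2006] I Thm. 2.13, Thm. 4.10.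
-/

set_option linter.dupNamespace false -- `Summit.<P>.<Sub>` repeats `BirchSwinnertonDyer` (D-0017)
set_option autoImplicit false

noncomputable section

open scoped Classical ContRepresentation

namespace Summit.BirchSwinnertonDyer.BirchSwinnertonDyer.Theorems.GenusSupplyNarrow.ArchBit

open WeierstrassCurve Field NumberField IsDedekindDomain Function
open Literature.NumberTheory.EllipticCurves Literature.NumberTheory.GaloisRepresentations
open Literature.NumberTheory.GaloisRepresentations.DiscreteGaloisModule (SelmerStructure)
open Literature.NumberTheory.GaloisCohomology
open Summit.BirchSwinnertonDyer.Rank1Residual.X11b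
open Summit.BirchSwinnertonDyer.Rank1Residual.X11b.CongruentTransfer
open Summit.BirchSwinnertonDyer.BirchSwinnertonDyer.Theorems.GenusKolyTwistLocal
open Summit.BirchSwinnertonDyer.BirchSwinnertonDyer.Theorems.GenusExact.PlusDescent
open Summit.BirchSwinnertonDyer.BirchSwinnertonDyer.Theorems.GenusKolyArch
open Summit.BirchSwinnertonDyer.BirchSwinnertonDyer.Theorems.SchneiderFreeAdditiveX3.PoitouTateReduction
  (poitouTate_selmerStructure_duality_real_holds)
open Rat.HeightOneSpectrum (primesEquiv natGenerator)

variable (W : WeierstrassCurve ℚ) [W.IsElliptic] [W.IsGloballyMinimal]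

/-! ## §1 A class of `E` non-trivial at `∞` halves `#Sel₂` from `E` to the twin -/

/-- **Mazur–Rubin Cor. 3.4 (i), NON-STRICT direction with `T = {∞}`, for the pair `(W, Wd)` (forwards) — UNCONDITIONAL.**  `W/ℚ` globally
minimal with `Δ_W > 0` and `C(W)` odd; `K` imaginary quadratic with odd `d_K`, Heegner for `N_W`, `2` split; `Wd = Cd • W^(d_K)` elliptic and
all-silent (`ord₂ C(Wd) = 0`).  IF some class of `Sel₂(W)` localises non-trivially at `∞`, THEN `#Sel₂(Wd)·2 = #Sel₂(W)`.
[cite: MazurRubin2010, Lemma 2.9, Prop. 3.3, Cor. 3.4 (i)] [cite: Kramer1981, §2 Prop. 6] -/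
theorem natCard_selmerGroup_twin_mul_two_eq_of_localization_real_ne_zero {K : Type} [Field K] [NumberField K]
    (hpos : 0 < W.Δ) (hK : IsImaginaryQuadratic K) (hodd : Odd (discr K)) (hH : SatisfiesHeegnerHypothesis (W.conductorNorm ℤ) K)
    (h2K : ((Ideal.span {(2 : ℤ)}).primesOver (𝓞 K)).ncard = 2) (hTam : Odd W.tamagawaProduct)
    {Wd : WeierstrassCurve ℚ} [Wd.IsElliptic] (Cd : VariableChange ℚ) (hCd : Cd • W.quadraticTwist (discr K : ℚ) = Wd)
    (hDEF : padicValNat 2 Wd.tamagawaProduct = 0)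
    (hns : ∃ c ∈ (W.kummerSelmerStructure ((2 : ℕ) : ℤ)).selmerGroup,
      galoisCohomology.localization (W.torsionGaloisModule ((2 : ℕ) : ℤ)) (Sum.inl Rat.infinitePlace) 1 c ≠ 0) :
    Nat.card (Wd.selmerGroup ((2 : ℕ) : ℤ)) * 2 = Nat.card (W.selmerGroup ((2 : ℕ) : ℤ)) := by
  haveI : Fact (Nat.Prime 2) := ⟨Nat.prime_two⟩
  have hd0 : (discr K : ℚ) ≠ 0 := by exact_mod_cast NumberField.discr_ne_zero K
  have hdneg : (discr K : ℚ) < 0 := by exact_mod_cast IsImaginaryQuadratic.discr_neg hK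
  -- the real place, `Δ_W, Δ_{Wd} > 0` there, `d_K` not a real square
  have hw₀ : (Rat.infinitePlace).IsReal := Rat.isReal_infinitePlace
  have hΔ' : 0 < InfinitePlace.embedding_of_isReal hw₀ W.Δ := by rwa [embedding_of_isReal_rat_apply, Rat.cast_pos]
  have hdsq₀ := forall_sq_ne_completion_of_neg hdneg Rat.infinitePlace
  -- Poitou–Tate and Tate's local Euler characteristic (tree theorems)
  have hPT := poitouTate_selmerStructure_duality_real_holds (K := ℚ)
  have hEP : ∀ v : HeightOneSpectrum (𝓞 ℚ), localEulerPoincareCharacteristic (v.adicCompletion ℚ) := fun v ↦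
    haveI : CharZero (v.adicCompletion ℚ) := charZero_of_injective_algebraMap (algebraMap ℚ _).injective
    localEulerPoincareCharacteristic_holds (v.adicCompletion ℚ)
  -- the master datum for `(W, Wd)`, used backwards
  obtain ⟨φ, ψ, hψφ, hφψ, hsplit, -, -, hreal, -⟩ := exists_intertwining_master_frame W Wd hd0 hCd
  have hundo : ∀ (v : Place ℚ) (X : AddSubgroup (galoisCohomology ((Wd.torsionGaloisModule ((2 : ℕ) : ℤ)).toLocal v) 1)),
      (X.map (galoisCohomology.map (φ.restrictField (Place.Completion v)) 1)).map
        (galoisCohomology.map (ψ.restrictField (Place.Completion v)) 1) = X := by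
    intro v X
    rw [AddSubgroup.map_map]
    conv_rhs => rw [← AddSubgroup.map_id X]
    congr 1
    ext x
    exact map_restrictField_map_restrictField_of_comp_eq φ ψ hψφ v x
  let 𝓐 : SelmerStructure (Wd.torsionGaloisModule ((2 : ℕ) : ℤ)) := fun v ↦
    (W.kummerSelmerStructure ((2 : ℕ) : ℤ) v).map (galoisCohomology.map (ψ.restrictField (Place.Completion v)) 1)
  have h𝓐 : ∀ v, 𝓐 v = (W.kummerSelmerStructure ((2 : ℕ) : ℤ) v).map
      (galoisCohomology.map (ψ.restrictField (Place.Completion v)) 1) := fun _ ↦ rfl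
  have hsplit' : ∀ v : Place ℚ, (∃ s : Place.Completion v, s ^ 2 = algebraMap ℚ (Place.Completion v) (discr K : ℚ)) →
      𝓐 v = Wd.kummerSelmerStructure ((2 : ℕ) : ℤ) v := by
    intro v hs
    rw [h𝓐, kummerSelmerStructure_apply, kummerSelmerStructure_apply, ← hsplit (Place.Completion v) hs, hundo]
  -- agreement at every finite place (three-row menu) — no infinite place other than `∞` over `ℚ`
  have hfin := menu₃_finite_rat_of_allSilent_of_two_split W hK hodd hH h2K hTam Cd hCd hDEF
  have hagree : ∀ v : Place ℚ, v ≠ Sum.inl Rat.infinitePlace → 𝓐 v = Wd.kummerSelmerStructure ((2 : ℕ) : ℤ) v := by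
    rintro (w | v) hv
    · exact absurd (congrArg Sum.inl (Subsingleton.elim w Rat.infinitePlace)) hv
    · rcases hfin v with ⟨s, hs⟩ | ⟨h2v, hvWd, hvW⟩ | ⟨h2v, h1Wd, h1W⟩
      · exact hsplit' (Sum.inr v) ⟨s, hs⟩
      · exact transport_kummer_inr_eq_of_good Wd W 2 ψ φ hψφ 𝓐 h𝓐 h2v hvWd hvW
      · rw [h𝓐, kummerSelmerStructure_apply, kummerSelmerStructure_apply]
        exact map_kummerLocalConditionAt_adicCompletion_eq_of_natCard_ker_eq_one Wd W v two_ne_zero h2v h1Wd h1W ψ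
  -- the structure transported FORWARDS: `𝓐′ v = φ_* 𝓛_v(Wd)` on `H¹(ℚ_v, E[2])`
  have hundo' : ∀ (v : Place ℚ) (X : AddSubgroup (galoisCohomology ((W.torsionGaloisModule ((2 : ℕ) : ℤ)).toLocal v) 1)),
      (X.map (galoisCohomology.map (ψ.restrictField (Place.Completion v)) 1)).map
        (galoisCohomology.map (φ.restrictField (Place.Completion v)) 1) = X := by
    intro v X
    rw [AddSubgroup.map_map]
    conv_rhs => rw [← AddSubgroup.map_id X]
    congr 1
    ext x
    exact map_restrictField_map_restrictField_of_comp_eq ψ φ hφψ v x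
  let 𝓐' : SelmerStructure (W.torsionGaloisModule ((2 : ℕ) : ℤ)) := fun v ↦
    (Wd.kummerSelmerStructure ((2 : ℕ) : ℤ) v).map (galoisCohomology.map (φ.restrictField (Place.Completion v)) 1)
  have h𝓐' : ∀ v, 𝓐' v = (Wd.kummerSelmerStructure ((2 : ℕ) : ℤ) v).map
      (galoisCohomology.map (φ.restrictField (Place.Completion v)) 1) := fun _ ↦ rfl
  have hagree' : ∀ v : Place ℚ, v ≠ Sum.inl Rat.infinitePlace → 𝓐' v = W.kummerSelmerStructure ((2 : ℕ) : ℤ) v := by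
    intro v hv
    rw [h𝓐', ← hagree v hv, h𝓐, hundo']
  -- transversality at `∞`: the master datum's real clause, verbatim
  have htr' : 𝓐' (Sum.inl Rat.infinitePlace) ⊓ W.kummerSelmerStructure ((2 : ℕ) : ℤ) (Sum.inl Rat.infinitePlace) = ⊥ := by
    rw [h𝓐', kummerSelmerStructure_apply, kummerSelmerStructure_apply]
    exact hreal Rat.infinitePlace hw₀ hΔ' hdsq₀
  exact natCard_selmerGroup_mul_eq_of_transverse_inl_of_localization_ne_zero W Wd 2 hPT hEP φ ψ hψφ hφψ 𝓐' h𝓐' Rat.infinitePlace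
    hagree' htr' (natCard_kummerSelmerStructure_inl_eq_two_of_isReal W hw₀ hΔ') hns

/-! ## §2 The K₄⁺ cell: `#Sel₂(Wd) = 2`, strict at `∞` -/

/-- **On the K₄⁺ cell the all-silent twin has `#Sel₂(Wd) = 2`** (`#Sel₂(W) = 4` and a class of `Sel₂(W)` non-trivial at `∞` — the K₄⁺ clause of
the crux verbatim): `#Sel₂(Wd)·2 = 4`.  UNCONDITIONAL (no Gross–Zagier–Kolyvagin, no parity, no BSD): the `2`-Selmer-minimality of the twin,
asked by the frame `C⁺‴`, is automatic on this cell. [cite: MazurRubin2010, Cor. 3.4 (i)] [cite: Kramer1981, §2 Prop. 6, Thm. 1] -/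
theorem natCard_selmerGroup_twin_eq_two_of_kFourPos {K : Type} [Field K] [NumberField K]
    (hpos : 0 < W.Δ) (hK : IsImaginaryQuadratic K) (hodd : Odd (discr K)) (hH : SatisfiesHeegnerHypothesis (W.conductorNorm ℤ) K)
    (h2K : ((Ideal.span {(2 : ℤ)}).primesOver (𝓞 K)).ncard = 2) (hTam : Odd W.tamagawaProduct)
    (h4 : Nat.card (W.selmerGroup 2) = 4 ∧ ∃ c ∈ (W.kummerSelmerStructure ((2 : ℕ) : ℤ)).selmerGroup,
      galoisCohomology.localization (W.torsionGaloisModule ((2 : ℕ) : ℤ)) (Sum.inl Rat.infinitePlace) 1 c ≠ 0)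
    {Wd : WeierstrassCurve ℚ} [Wd.IsElliptic] (Cd : VariableChange ℚ) (hCd : Cd • W.quadraticTwist (discr K : ℚ) = Wd)
    (hDEF : padicValNat 2 Wd.tamagawaProduct = 0) :
    Nat.card (Wd.selmerGroup 2) = 2 := by
  have h := natCard_selmerGroup_twin_mul_two_eq_of_localization_real_ne_zero W hpos hK hodd hH h2K hTam Cd hCd hDEF h4.2
  simp only [Nat.cast_ofNat] at h
  rw [h4.1] at h
  omega

/-- **On the K₄⁺ cell every class of `Sel₂(Wd)` is STRICT at `∞`** (`…OnFour` with the now automatic `#Sel₂(Wd) = 2`): `Sel₂(Wd)` is the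
strict-at-`∞` part of `Sel₂(E)`, of order `2`.  UNCONDITIONAL. [cite: MazurRubin2010, Cor. 3.4 (i)] [cite: Kramer1981, §2 Prop. 6] -/
theorem twin_selmer_localization_real_eq_zero_of_kFourPos {K : Type} [Field K] [NumberField K]
    (hpos : 0 < W.Δ) (hK : IsImaginaryQuadratic K) (hodd : Odd (discr K)) (hH : SatisfiesHeegnerHypothesis (W.conductorNorm ℤ) K)
    (h2K : ((Ideal.span {(2 : ℤ)}).primesOver (𝓞 K)).ncard = 2) (hTam : Odd W.tamagawaProduct)
    (h4 : Nat.card (W.selmerGroup 2) = 4 ∧ ∃ c ∈ (W.kummerSelmerStructure ((2 : ℕ) : ℤ)).selmerGroup,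
      galoisCohomology.localization (W.torsionGaloisModule ((2 : ℕ) : ℤ)) (Sum.inl Rat.infinitePlace) 1 c ≠ 0)
    {Wd : WeierstrassCurve ℚ} [Wd.IsElliptic] (Cd : VariableChange ℚ) (hCd : Cd • W.quadraticTwist (discr K : ℚ) = Wd)
    (hDEF : padicValNat 2 Wd.tamagawaProduct = 0) :
    ∀ c ∈ (Wd.kummerSelmerStructure ((2 : ℕ) : ℤ)).selmerGroup,
      galoisCohomology.localization (Wd.torsionGaloisModule ((2 : ℕ) : ℤ)) (Sum.inl Rat.infinitePlace) 1 c = 0 :=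
  twin_selmer_localization_real_eq_zero_of_natCard_selmerGroup_eq_four W hpos hK hodd hH h2K hTam h4.1 Cd hCd hDEF
    (natCard_selmerGroup_twin_eq_two_of_kFourPos W hpos hK hodd hH h2K hTam h4 Cd hCd hDEF)

/-! ## §3 The third line: on a `#Sel₂(E) = 4` cell STRICT at `∞` the all-silent twin has `#Sel₂(Wd) = 8` — the K₄⁺ clause is forced by the frame -/

/-- **Mazur–Rubin Cor. 3.4 (i), UP direction with `T = {∞}`, for `(W, Wd)`: `#Sel₂(W) = 4` with EVERY class strict at `∞` ⟹ `#Sel₂(Wd) = 8`.**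
Same frame as §1 (all-silent twin, `2` split).  The parity input of the UP engine
(`GenusKolyArch.natCard_selmerGroup_eq_mul_of_transverse_inl_of_forall_localization_eq_zero`) is `IsSquare (#Sel₂(Wd)·#Sel₂(W)·#𝓛_∞(W))
= IsSquare (8·#Sel₂(Wd))`, supplied by gk2-p3's dichotomy `#Sel₂(Wd) ∈ {2, 8}` (`PlusDescent.natCard_selmerGroup_twin_eq_two_or_eq_eight_of_natCard_eq_four`).
UNCONDITIONAL. [cite: MazurRubin2010, Thm. 2.7, Prop. 3.3, Cor. 3.4 (i)] [cite: Kramer1981, §2 Prop. 6, Thm. 1] -/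
theorem natCard_selmerGroup_twin_eq_eight_of_forall_localization_real_eq_zero {K : Type} [Field K] [NumberField K]
    (hpos : 0 < W.Δ) (hK : IsImaginaryQuadratic K) (hodd : Odd (discr K)) (hH : SatisfiesHeegnerHypothesis (W.conductorNorm ℤ) K)
    (h2K : ((Ideal.span {(2 : ℤ)}).primesOver (𝓞 K)).ncard = 2) (hTam : Odd W.tamagawaProduct)
    (h4 : Nat.card (W.selmerGroup 2) = 4)
    (hstrict : ∀ c ∈ (W.kummerSelmerStructure ((2 : ℕ) : ℤ)).selmerGroup,
      galoisCohomology.localization (W.torsionGaloisModule ((2 : ℕ) : ℤ)) (Sum.inl Rat.infinitePlace) 1 c = 0)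
    {Wd : WeierstrassCurve ℚ} [Wd.IsElliptic] (Cd : VariableChange ℚ) (hCd : Cd • W.quadraticTwist (discr K : ℚ) = Wd)
    (hDEF : padicValNat 2 Wd.tamagawaProduct = 0) :
    Nat.card (Wd.selmerGroup 2) = 8 := by
  haveI : Fact (Nat.Prime 2) := ⟨Nat.prime_two⟩
  have hd0 : (discr K : ℚ) ≠ 0 := by exact_mod_cast NumberField.discr_ne_zero K
  have hdneg : (discr K : ℚ) < 0 := by exact_mod_cast IsImaginaryQuadratic.discr_neg hK
  -- the real place, `Δ_W, Δ_{Wd} > 0` there, `d_K` not a real square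
  have hw₀ : (Rat.infinitePlace).IsReal := Rat.isReal_infinitePlace
  have hΔ' : 0 < InfinitePlace.embedding_of_isReal hw₀ W.Δ := by rwa [embedding_of_isReal_rat_apply, Rat.cast_pos]
  have hdsq₀ := forall_sq_ne_completion_of_neg hdneg Rat.infinitePlace
  -- Poitou–Tate and Tate's local Euler characteristic (tree theorems)
  have hPT := poitouTate_selmerStructure_duality_real_holds (K := ℚ)
  have hEP : ∀ v : HeightOneSpectrum (𝓞 ℚ), localEulerPoincareCharacteristic (v.adicCompletion ℚ) := fun v ↦
    haveI : CharZero (v.adicCompletion ℚ) := charZero_of_injective_algebraMap (algebraMap ℚ _).injective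
    localEulerPoincareCharacteristic_holds (v.adicCompletion ℚ)
  -- the master datum for `(W, Wd)`, used backwards
  obtain ⟨φ, ψ, hψφ, hφψ, hsplit, -, -, hreal, -⟩ := exists_intertwining_master_frame W Wd hd0 hCd
  have hundo : ∀ (v : Place ℚ) (X : AddSubgroup (galoisCohomology ((Wd.torsionGaloisModule ((2 : ℕ) : ℤ)).toLocal v) 1)),
      (X.map (galoisCohomology.map (φ.restrictField (Place.Completion v)) 1)).map
        (galoisCohomology.map (ψ.restrictField (Place.Completion v)) 1) = X := by
    intro v X
    rw [AddSubgroup.map_map]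
    conv_rhs => rw [← AddSubgroup.map_id X]
    congr 1
    ext x
    exact map_restrictField_map_restrictField_of_comp_eq φ ψ hψφ v x
  let 𝓐 : SelmerStructure (Wd.torsionGaloisModule ((2 : ℕ) : ℤ)) := fun v ↦
    (W.kummerSelmerStructure ((2 : ℕ) : ℤ) v).map (galoisCohomology.map (ψ.restrictField (Place.Completion v)) 1)
  have h𝓐 : ∀ v, 𝓐 v = (W.kummerSelmerStructure ((2 : ℕ) : ℤ) v).map
      (galoisCohomology.map (ψ.restrictField (Place.Completion v)) 1) := fun _ ↦ rfl
  have hsplit' : ∀ v : Place ℚ, (∃ s : Place.Completion v, s ^ 2 = algebraMap ℚ (Place.Completion v) (discr K : ℚ)) →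
      𝓐 v = Wd.kummerSelmerStructure ((2 : ℕ) : ℤ) v := by
    intro v hs
    rw [h𝓐, kummerSelmerStructure_apply, kummerSelmerStructure_apply, ← hsplit (Place.Completion v) hs, hundo]
  -- agreement at every finite place (three-row menu) — no infinite place other than `∞` over `ℚ`
  have hfin := menu₃_finite_rat_of_allSilent_of_two_split W hK hodd hH h2K hTam Cd hCd hDEF
  have hagree : ∀ v : Place ℚ, v ≠ Sum.inl Rat.infinitePlace → 𝓐 v = Wd.kummerSelmerStructure ((2 : ℕ) : ℤ) v := by
    rintro (w | v) hv
    · exact absurd (congrArg Sum.inl (Subsingleton.elim w Rat.infinitePlace)) hv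
    · rcases hfin v with ⟨s, hs⟩ | ⟨h2v, hvWd, hvW⟩ | ⟨h2v, h1Wd, h1W⟩
      · exact hsplit' (Sum.inr v) ⟨s, hs⟩
      · exact transport_kummer_inr_eq_of_good Wd W 2 ψ φ hψφ 𝓐 h𝓐 h2v hvWd hvW
      · rw [h𝓐, kummerSelmerStructure_apply, kummerSelmerStructure_apply]
        exact map_kummerLocalConditionAt_adicCompletion_eq_of_natCard_ker_eq_one Wd W v two_ne_zero h2v h1Wd h1W ψ
  -- the structure transported FORWARDS: `𝓐′ v = φ_* 𝓛_v(Wd)` on `H¹(ℚ_v, E[2])`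
  have hundo' : ∀ (v : Place ℚ) (X : AddSubgroup (galoisCohomology ((W.torsionGaloisModule ((2 : ℕ) : ℤ)).toLocal v) 1)),
      (X.map (galoisCohomology.map (ψ.restrictField (Place.Completion v)) 1)).map
        (galoisCohomology.map (φ.restrictField (Place.Completion v)) 1) = X := by
    intro v X
    rw [AddSubgroup.map_map]
    conv_rhs => rw [← AddSubgroup.map_id X]
    congr 1
    ext x
    exact map_restrictField_map_restrictField_of_comp_eq ψ φ hφψ v x
  let 𝓐' : SelmerStructure (W.torsionGaloisModule ((2 : ℕ) : ℤ)) := fun v ↦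
    (Wd.kummerSelmerStructure ((2 : ℕ) : ℤ) v).map (galoisCohomology.map (φ.restrictField (Place.Completion v)) 1)
  have h𝓐' : ∀ v, 𝓐' v = (Wd.kummerSelmerStructure ((2 : ℕ) : ℤ) v).map
      (galoisCohomology.map (φ.restrictField (Place.Completion v)) 1) := fun _ ↦ rfl
  have hagree' : ∀ v : Place ℚ, v ≠ Sum.inl Rat.infinitePlace → 𝓐' v = W.kummerSelmerStructure ((2 : ℕ) : ℤ) v := by
    intro v hv
    rw [h𝓐', ← hagree v hv, h𝓐, hundo']
  -- transversality at `∞`: the master datum's real clause, verbatim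
  have htr' : 𝓐' (Sum.inl Rat.infinitePlace) ⊓ W.kummerSelmerStructure ((2 : ℕ) : ℤ) (Sum.inl Rat.infinitePlace) = ⊥ := by
    rw [h𝓐', kummerSelmerStructure_apply, kummerSelmerStructure_apply]
    exact hreal Rat.infinitePlace hw₀ hΔ' hdsq₀
  -- the parity input: `#Sel₂(Wd) ∈ {2, 8}`, `#𝓛_∞(W) = 2`
  have ht : Nat.card (W.kummerSelmerStructure ((2 : ℕ) : ℤ) (Sum.inl Rat.infinitePlace)) = 2 :=
    natCard_kummerSelmerStructure_inl_eq_two_of_isReal W hw₀ hΔ'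
  have hrelidx : (𝓐' (Sum.inl Rat.infinitePlace)).relIndex (W.kummerSelmerStructure ((2 : ℕ) : ℤ) (Sum.inl Rat.infinitePlace)) = 2 := by
    rw [← AddSubgroup.inf_relIndex_right, htr', AddSubgroup.relIndex_bot_left, ht]
  have h4' : Nat.card (W.selmerGroup ((2 : ℕ) : ℤ)) = 4 := h4
  have h28 := natCard_selmerGroup_twin_eq_two_or_eq_eight_of_natCard_eq_four W hpos hTam h4 hK hodd hH Wd ⟨Cd, hCd⟩ hDEF
  have hpar : IsSquare (Nat.card (Wd.selmerGroup ((2 : ℕ) : ℤ)) * Nat.card (W.selmerGroup ((2 : ℕ) : ℤ)) *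
      (𝓐' (Sum.inl Rat.infinitePlace)).relIndex (W.kummerSelmerStructure ((2 : ℕ) : ℤ) (Sum.inl Rat.infinitePlace))) := by
    rw [hrelidx, h4']
    rcases h28 with h | h
    · have h' : Nat.card (Wd.selmerGroup ((2 : ℕ) : ℤ)) = 2 := h
      rw [h']
      exact ⟨4, by norm_num⟩
    · have h' : Nat.card (Wd.selmerGroup ((2 : ℕ) : ℤ)) = 8 := h
      rw [h']
      exact ⟨8, by norm_num⟩
  have h := natCard_selmerGroup_eq_mul_of_transverse_inl_of_forall_localization_eq_zero W Wd 2 hPT hEP φ ψ hψφ hφψ 𝓐' h𝓐'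
    Rat.infinitePlace hagree' htr' ht hstrict hpar
  rw [h4'] at h
  exact h

/-- **The K₄⁺ clause is FORCED by the frame**: on the all-silent `2`-split frame, `#Sel₂(E) = 4` together with the frame's `#Sel₂(Wd) = 2`
implies that some class of `Sel₂(E)` is NON-trivial at `∞` (else §3 gives `#Sel₂(Wd) = 8`).  So the crux's side condition
`∃ c ∈ Sel₂(E), loc_∞ c ≠ 0` on the `#Sel₂(E) = 4` cell is exactly the INHABITED part of that cell for `2`-Selmer-minimal twins: the third
line (`Sel₂(E)` strict at `∞`) carries no frame.  UNCONDITIONAL. [cite: MazurRubin2010, Prop. 3.3, Cor. 3.4 (i)] [cite: Kramer1981, §2 Prop. 6] -/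
theorem exists_localization_real_ne_zero_of_natCard_selmerGroup_twin_eq_two {K : Type} [Field K] [NumberField K]
    (hpos : 0 < W.Δ) (hK : IsImaginaryQuadratic K) (hodd : Odd (discr K)) (hH : SatisfiesHeegnerHypothesis (W.conductorNorm ℤ) K)
    (h2K : ((Ideal.span {(2 : ℤ)}).primesOver (𝓞 K)).ncard = 2) (hTam : Odd W.tamagawaProduct)
    (h4 : Nat.card (W.selmerGroup 2) = 4)
    {Wd : WeierstrassCurve ℚ} [Wd.IsElliptic] (Cd : VariableChange ℚ) (hCd : Cd • W.quadraticTwist (discr K : ℚ) = Wd)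
    (hDEF : padicValNat 2 Wd.tamagawaProduct = 0) (hSel : Nat.card (Wd.selmerGroup 2) = 2) :
    ∃ c ∈ (W.kummerSelmerStructure ((2 : ℕ) : ℤ)).selmerGroup,
      galoisCohomology.localization (W.torsionGaloisModule ((2 : ℕ) : ℤ)) (Sum.inl Rat.infinitePlace) 1 c ≠ 0 := by
  by_contra hno
  push Not at hno
  have h8 := natCard_selmerGroup_twin_eq_eight_of_forall_localization_real_eq_zero W hpos hK hodd hH h2K hTam h4 hno Cd hCd hDEF
  omega

end Summit.BirchSwinnertonDyer.BirchSwinnertonDyer.Theorems.GenusSupplyNarrow.ArchBit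

end
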